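import Summits.ResolutionOfSingularities.ResolutionOfSingularities.Theorems.FrobeniusLadderFInjectiveMacaulayficationWildPinchCylinder
import Summits.ResolutionOfSingularities.ResolutionOfSingularities.Theorems.FrobeniusLadderFInjectiveMacaulayficationRelClosedSubsetFixFinite
import Summits.ResolutionOfSingularities.ResolutionOfSingularities.Theorems.WeightedInvariantOrderSemicontinuousSmooth
import Literature.AlgebraicGeometry.Resolution.BlowupAlgebraPrimesPoints
import Mathlib.AlgebraicGeometry.Morphisms.FiniteType
import Mathlib.AlgebraicGeometry.Morphisms.Separated
import Mathlib.AlgebraicGeometry.Morphisms.UniversallyClosed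
import HarnessLib

/-!
# CONDITIONAL NEGATIVE: the power residual (T3′-pow) `RelClosedSubsetFixPow` is FALSE, modulo THEOREM W (C) at the wild-pinch cylinder
# (crux `FInjectiveMacaulayfication` stmt-ResolutionOfSingularities-15315, chain w45a; res-L1-w45a-plan-1 R16.29 (1)(3)(b); the kill is
# res-L1-w45a-tri-2's KILL-T3POW 21:10:06Z, the hypothesis is res-L1-w45a-strat-1's THEOREM W (C) read on blow-up models)

[OURS · L1 W4.5a · res-L1-w45a-stub-3] Support file (`--supports stmt-ResolutionOfSingularities-15315 --as helper`) for the crux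
`FrobeniusLadder.FInjectiveMacaulayfication`; NOT a statement of any manuscript; replaces the role of NOTHING in H. Hironaka's manuscript;
AI-written, weaker than expert review. ONE `Prop`-valued HYPOTHESIS is declared (OURS, not a fact, not a Literature result):
`WildPinchCylinderNoRelativeBlowupCure` = THEOREM W (C) of res-L1-w45a-strat-1 (memo H4LOC-KILL-WILDPINCH e222be87e80efea5, plan-1
R16.2 (C)/R16.3 (2), tri-2 reads #184/#185 — ON PAPER, not in Lean) SPECIALISED to (i) the field `K₀ = k(v₁,v₂)` realised as the residue
field of the generic point `η` of `P × 𝔸²` on the cylinder `X₁ = W × 𝔸² = Spec k[u,t,y,v₁,v₂]/(y² + u²ty + ut²)` (`char k = 2`), and (ii) BLOW-UP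
models: «no ideal sheaf `J` on `X₁` agreeing with `(u)ⁿ` (`n > 0`) at every proper generization of `η` has all the affine blow-up charts of
`J_η ⊆ 𝒪_{X₁,η}` FULL (domain ∧ CM clause ∧ F-clause, `p = 2`) at the primes over `𝔪_η`» — such a `Bl_{J_η} Spec 𝒪_{X₁,η}` is proper,
birational and an isomorphism over the punctured spectrum (there `J = (u)ⁿ` is invertible), so THEOREM W (C) («no proper birational model
of the wild pinch germ, iso off the closed point, is CM ∧ F-injective over the closed point») implies it; as a HYPOTHESIS it is WEAKER than
W (C), so the negative theorems below are STRONGER than «W (C) ⇒ ¬(T3′-pow)».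

PROVED (no sorry, no fact asserted):
* §1 the witness `X₁ = Spec R`, `R = k[X₀…X₄]/(F)` over `k = 𝔽₂` satisfies EVERY binder of the door's residual (affine ⇒ separated /
  quasi-compact; finite type; integral — `WildPinchCylinder.prime_F`; `4 ≤ dim` — `WildPinchCylinder.four_le_ringKrullDim`; CM clause at every
  stalk — `WildPinchCylinder.cmClause_localization` along `Spec.stalkIso`);
* §2 the CARTIER DATUM: `J₀ := (u)·𝒪_{X₁}` is an effective Cartier divisor, so every blow-up along `J₀` is an isomorphism (`IsBlowup.isIso`),
  and `GoodOver 2 X₁ J₀ (supp J₀ ∖ Z)`, `Z := closure {η}`, because the points of `V(u) ∖ V(u,t,y)` are REGULAR (`∂F/∂u = t²`,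
  `WildPinchCylinder.fullCl_localization_of_X1_not_mem`);
* §3 **`relClosedSubsetFixPow_false_of_W : WildPinchCylinderNoRelativeBlowupCure → ¬ FCUnguardedAprime.RelClosedSubsetFixPow`** — tri-2's
  reduction kernel-checked: the residual's output `J ≡ J₀ⁿ` off `Z`, good over `supp J`, has `η ∈ supp J` (via the generization `ξ₀ = V(u,y)`,
  `ξ₀ ∉ Z`, where `J = (u)ⁿ`), every point of a blow-up over `η` is NON-closed (properness: `{η}` is not closed) hence FULL, and the chart–point
  dictionary `IsBlowup.exists_point_of_blowupAlgebra_prime` (Stacks 0804) turns this into FULL charts of `J_η` over `𝔪_η` — contradicting the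
  hypothesis at `(J, n, c := generators of J_η)`; **`relClosedSubsetFix_false_of_W`** (the exact form (T3′), via `relClosedSubsetFixPow_of_fix`).
So the gate sees the dead currency: door v31's `stub_relClosedSubsetFixPow` is refuted modulo ONE named on-paper theorem of the chain.
[folklore assembly; cite: StacksProject, Tag 0804; GortzWedhorn2020, Prop. 13.91]
-/

-- single-problem summit: the doubled namespace component is forced
set_option linter.dupNamespace false

noncomputable section

open AlgebraicGeometry CategoryTheory Literature.AlgebraicGeometry.Resolution TopologicalSpace IsLocalRing MvPolynomial

namespace Summit.ResolutionOfSingularities.ResolutionOfSingularities.Theorems.FInjectiveMacaulayfication.RelClosedSubsetFixPowFalseOfW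

open Summit.ResolutionOfSingularities.ResolutionOfSingularities.Theorems.FInjectiveMacaulayfication
open Summit.ResolutionOfSingularities.ResolutionOfSingularities.Theorems.FInjectiveMacaulayfication.SliceableCentre (CMCl FCl FullCl)

/-! ## §0 The hypothesis: THEOREM W (C) on blow-up models at the cylinder germ -/

/-- [OURS · HYPOTHESIS, not a fact — THEOREM W (C) of res-L1-w45a-strat-1 (on paper; H4LOC-KILL-WILDPINCH, plan-1 R16.2 (C)/R16.3 (2))
specialised to blow-up models at the cylinder germ] **No relative blow-up cure of the wild pinch cylinder at `η`.** For every field `k` of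
characteristic `2`, on `X₁ = Spec k[X₀,…,X₄]/(F)`, `F = X₂² + X₀²X₁X₂ + X₀X₁²` (`= W × 𝔸²`, `u = X₀`, `t = X₁`, `y = X₂`), at the generic point `η`
of `V(u,t,y) = P × 𝔸²` (local ring = the wild pinch germ over `k(v₁,v₂)`): for NO ideal sheaf `J`, exponent `n > 0` and finite family `c` in
`𝒪_{X₁,η}` generating `J_η` such that `J` agrees with `((u)·𝒪)ⁿ` at every proper generization of `η`, are all the affine blow-up charts
`𝒪_{X₁,η}[(c)/c_j]` FULL (`p = 2`) at every prime over `𝔪_η`. (Then `Bl_{(c)} Spec 𝒪_{X₁,η}` would be a proper birational model, an isomorphism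
over the punctured spectrum, CM ∧ F-injective at every point over the closed point — excluded by THEOREM W (C) through the field-free
Frobenius normal form `d ↦ b d²` on the conductor-supported part of `H²_𝔪`.) Weaker than W (C); consumed only as a hypothesis. [OURS ·
candidate, paper-proved by the chain, NOT kernel-proved] -/
@[conjecture] def WildPinchCylinderNoRelativeBlowupCure : Prop :=
  ∀ (k : Type) [Field k] [CharP k 2] (F : MvPolynomial (Fin 5) k), F = X 2 ^ 2 + X 0 ^ 2 * X 1 * X 2 + X 0 * X 1 ^ 2 →
    ∀ (η : Spec (.of (MvPolynomial (Fin 5) k ⧸ Ideal.span {F}))),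
      η.asIdeal = (Ideal.span (MvPolynomial.X '' ({0, 1, 2} : Set (Fin 5)) : Set (MvPolynomial (Fin 5) k))).map
        (Ideal.Quotient.mk (Ideal.span {F})) →
    ∀ (J : (Spec (.of (MvPolynomial (Fin 5) k ⧸ Ideal.span {F}))).IdealSheafData) (n m : ℕ)
      (c : Fin m → (Spec (.of (MvPolynomial (Fin 5) k ⧸ Ideal.span {F}))).presheaf.stalk η), 0 < n →
      Ideal.span (Set.range c) = stalkIdeal J η →
      (∀ y : Spec (.of (MvPolynomial (Fin 5) k ⧸ Ideal.span {F})), y ⤳ η → y ≠ η →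
        stalkIdeal J y = stalkIdeal (Scheme.IdealSheafData.ofIdealTop
          (Ideal.span {(Scheme.ΓSpecIso (.of (MvPolynomial (Fin 5) k ⧸ Ideal.span {F}))).inv
            (Ideal.Quotient.mk (Ideal.span {F}) (X 0))})) y ^ n) →
      ¬ ∀ (j : Fin m) (𝔔 : PrimeSpectrum (blowupAlgebra (Ideal.span (Set.range c)) (c j))),
          𝔔.asIdeal.comap (algebraMap _ (blowupAlgebra (Ideal.span (Set.range c)) (c j))) =
            maximalIdeal ((Spec (.of (MvPolynomial (Fin 5) k ⧸ Ideal.span {F}))).presheaf.stalk η) →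
          FullCl 2 (Localization.AtPrime 𝔔.asIdeal)

/-! ## §1 Sections, points and stalks of `Spec R` -/

section Witness

variable (k : Type) [Field k] (F : MvPolynomial (Fin 5) k) (hF : F = X 2 ^ 2 + X 0 ^ 2 * X 1 * X 2 + X 0 * X 1 ^ 2)

/-- The germ at `x` of the global section of `Spec R` attached to `r ∈ R` is a unit iff `r ∉ 𝔭_x`. [plumbing] -/
theorem isUnit_germ_iff (r : MvPolynomial (Fin 5) k ⧸ Ideal.span {F}) (x : Spec (.of (MvPolynomial (Fin 5) k ⧸ Ideal.span {F}))) :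
    IsUnit ((Spec (.of (MvPolynomial (Fin 5) k ⧸ Ideal.span {F}))).presheaf.germ ⊤ x trivial
      ((Scheme.ΓSpecIso (.of (MvPolynomial (Fin 5) k ⧸ Ideal.span {F}))).inv r)) ↔ r ∉ x.asIdeal := by
  rw [← Scheme.mem_basicOpen_top, basicOpen_eq_of_affine]
  exact PrimeSpectrum.mem_basicOpen r x

/-- The stalk at `x` of the ideal sheaf `(r)·𝒪` lies in `𝔪_x` iff `r ∈ 𝔭_x`; i.e. `x ∈ supp ((r)·𝒪) ↔ r ∈ 𝔭_x`. [plumbing] -/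
theorem mem_support_ofIdealTop_iff (r : MvPolynomial (Fin 5) k ⧸ Ideal.span {F})
    (x : Spec (.of (MvPolynomial (Fin 5) k ⧸ Ideal.span {F}))) :
    x ∈ ((Scheme.IdealSheafData.ofIdealTop (Ideal.span {(Scheme.ΓSpecIso (.of (MvPolynomial (Fin 5) k ⧸ Ideal.span {F}))).inv r}) :
        (Spec (.of (MvPolynomial (Fin 5) k ⧸ Ideal.span {F}))).IdealSheafData).support :
      Set (Spec (.of (MvPolynomial (Fin 5) k ⧸ Ideal.span {F})))) ↔ r ∈ x.asIdeal := by
  change x ∈ (Scheme.IdealSheafData.ofIdealTop _).support ↔ _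
  rw [mem_support_iff_stalkIdeal_le, OrderSemicontinuity.stalkIdeal_ofIdealTop_span_singleton, Ideal.span_le,
    Set.singleton_subset_iff, SetLike.mem_coe, IsLocalRing.mem_maximalIdeal, mem_nonunits_iff, isUnit_germ_iff, not_not]

include hF in
/-- In `R`, `ȳ² ∈ (ū)`, so every prime containing `ū` contains `ȳ`. [folklore] -/
theorem mk_X2_mem_of_mk_X0_mem (Q : Ideal (MvPolynomial (Fin 5) k ⧸ Ideal.span {F})) [Q.IsPrime]
    (hu : Ideal.Quotient.mk (Ideal.span {F}) (X 0) ∈ Q) : Ideal.Quotient.mk (Ideal.span {F}) (X 2) ∈ Q := by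
  apply Ideal.IsPrime.mem_of_pow_mem ‹Q.IsPrime› 2
  have e : Ideal.Quotient.mk (Ideal.span {F}) (X 2) ^ 2 =
      Ideal.Quotient.mk (Ideal.span {F}) (X 0) * Ideal.Quotient.mk (Ideal.span {F}) (-(X 0 * X 1 * X 2 + X 1 ^ 2)) := by
    rw [← map_pow, ← map_mul, Ideal.Quotient.eq, Ideal.mem_span_singleton]
    exact ⟨1, by rw [hF]; ring⟩
  rw [e]
  exact Q.mul_mem_right _ hu

end Witness

/-! ## §2 The negative -/

/-- [OURS · L1 W4.5a · CONDITIONAL NEGATIVE — res-L1-w45a-plan-1 R16.29 (3)(b); reduction = res-L1-w45a-tri-2 KILL-T3POW 21:10:06Z]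
**The residual of record (T3′-pow) `RelClosedSubsetFixPow` is FALSE, modulo THEOREM W (C) at the cylinder germ.** Witness: `k = 𝔽₂`,
`X₁ = Spec k[X₀,…,X₄]/(X₂² + X₀²X₁X₂ + X₀X₁²)` (= `W × 𝔸²`; integral, 4-dimensional, all stalks CM — a hypersurface), `J₀ := (u)·𝒪` (an effective
Cartier divisor: every blow-up along it is an ISOMORPHISM, so `J₀` is good over `supp J₀ ∖ Z = V(u) ∖ V(u,t,y)`, whose points are REGULAR
since `∂F/∂u = t²`), `Z := closure {η}`, `η` = generic point of `V(u,t,y)`. The residual returns `J ≡ (u)ⁿ` off `Z`, `n > 0`, good over `supp J`;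
`η ∈ supp J` (test at the generization `ξ₀ = V(u,y) ∉ Z`), the points of a blow-up over the NON-closed `η` are non-closed (properness), hence
FULL, hence — by the chart–point dictionary (Stacks 0804, `IsBlowup.exists_point_of_blowupAlgebra_prime`) — every chart of `J_η` is FULL over
`𝔪_η`, against the hypothesis at `(J, n, c := generators of J_η)`. [folklore assembly; cite: StacksProject, Tag 0804] -/
theorem relClosedSubsetFixPow_false_of_W (hW : WildPinchCylinderNoRelativeBlowupCure) :
    ¬ FCUnguardedAprime.RelClosedSubsetFixPow := by
  intro h
  -- the witness
  let k : Type := ZMod 2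
  let F : MvPolynomial (Fin 5) k := X 2 ^ 2 + X 0 ^ 2 * X 1 * X 2 + X 0 * X 1 ^ 2
  have hF : F = X 2 ^ 2 + X 0 ^ 2 * X 1 * X 2 + X 0 * X 1 ^ 2 := rfl
  let R : Type := MvPolynomial (Fin 5) k ⧸ Ideal.span {F}
  haveI : IsDomain R := WildPinchCylinder.isDomain_quotient k F hF
  let X₁ : Scheme.{0} := Spec (.of R)
  let mk : MvPolynomial (Fin 5) k →+* R := Ideal.Quotient.mk (Ideal.span {F})
  -- the binders of the residual
  let f₁ : X₁ ⟶ Spec (.of k) := Spec.map (CommRingCat.ofHom (algebraMap k R))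
  have hft : LocallyOfFiniteType f₁ :=
    (HasRingHomProperty.Spec_iff (P := @LocallyOfFiniteType)).mpr (RingHom.finiteType_algebraMap.mpr inferInstance)
  have hsep : IsSeparated f₁ := inferInstance
  have hqc : QuasiCompact f₁ := inferInstance
  have hint : IsIntegral X₁ := inferInstance
  have estalk : ∀ x : X₁, X₁.presheaf.stalk x ≃+* Localization.AtPrime x.asIdeal := fun x =>
    (Spec.stalkIso (.of R) x).commRingCatIsoToRingEquiv
  have h4 : 4 ≤ topologicalKrullDim X₁ := by
    rw [show topologicalKrullDim X₁ = ringKrullDim R from PrimeSpectrum.topologicalKrullDim_eq_ringKrullDim R]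
    exact WildPinchCylinder.four_le_ringKrullDim k F hF
  have hCM : ∀ x : X₁, CMCl (X₁.presheaf.stalk x) := fun x =>
    FiLocusOpenOfAffine.cmClause_of_ringEquiv (estalk x).symm (WildPinchCylinder.cmClause_localization k F hF x.asIdeal)
  -- the point `η`, its generization `ξ₀`, the section `s_u` and the Cartier datum `J₀ = (u)·𝒪`
  let P : Set (Fin 5) → Ideal R := fun S => (Ideal.span (MvPolynomial.X '' S : Set (MvPolynomial (Fin 5) k))).map mk
  have hP : ∀ S : Set (Fin 5), (0 : Fin 5) ∈ S → (2 : Fin 5) ∈ S → (P S).IsPrime := fun S h0 h2 =>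
    (WildPinchCylinder.isPrime_map_span_X k F hF h0 h2).1
  have hXmem : ∀ (S : Set (Fin 5)) (i : Fin 5), i ∈ S → mk (X i) ∈ P S := fun S i hi =>
    Ideal.mem_map_of_mem _ (Ideal.subset_span ⟨i, hi, rfl⟩)
  have hXnot : ∀ (S : Set (Fin 5)) (i : Fin 5), (0 : Fin 5) ∈ S → (2 : Fin 5) ∈ S → i ∉ S → mk (X i) ∉ P S := by
    intro S i h0 h2 hi hmem
    have : (X i : MvPolynomial (Fin 5) k) ∈ Ideal.span (MvPolynomial.X '' S : Set (MvPolynomial (Fin 5) k)) := by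
      rw [← (WildPinchCylinder.isPrime_map_span_X k F hF h0 h2).2]
      exact Ideal.mem_comap.mpr hmem
    exact Literature.AlgebraicGeometry.Resolution.MvPolynomial.X_not_mem_span_X (R := k) S hi this
  let η : X₁ := ⟨P {0, 1, 2}, hP _ (by simp) (by simp)⟩
  let ξ₀ : X₁ := ⟨P {0, 2}, hP _ (by simp) (by simp)⟩
  -- specialization in `Spec R` is inclusion of primes
  have hspec : ∀ x y : X₁, x ⤳ y ↔ x.asIdeal ≤ y.asIdeal := fun x y =>
    (PrimeSpectrum.le_iff_specializes x y).symm.trans (PrimeSpectrum.asIdeal_le_asIdeal x y).symm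
  have hξη : ξ₀ ⤳ η := (hspec ξ₀ η).mpr
    (Ideal.map_mono (Ideal.span_mono (Set.image_mono (by intro i hi; simp only [Set.mem_insert_iff, Set.mem_singleton_iff] at hi ⊢; tauto))))
  have hξne : ξ₀ ≠ η := by
    intro heq
    have h1 : mk (X 1) ∈ P {0, 2} := by
      have : mk (X 1) ∈ η.asIdeal := hXmem _ 1 (by simp)
      rw [← heq] at this
      exact this
    exact hXnot {0, 2} 1 (by simp) (by simp) (by simp) h1
  have hηncl : ¬ IsClosed ({η} : Set X₁) := by
    intro hcl
    have hmax := (PrimeSpectrum.isClosed_singleton_iff_isMaximal η).mp hcl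
    have hlt : P {0, 1, 2} < P {0, 1, 2, 3} :=
      WildPinchCylinder.map_span_X_lt k F hF (S := {0, 1, 2}) (T := {0, 1, 2, 3}) (by simp) (by simp)
        (by intro i hi; simp only [Set.mem_insert_iff, Set.mem_singleton_iff] at hi ⊢; tauto) (j := 3) (by simp) (by simp)
    exact hlt.ne (hmax.eq_of_le (hP {0, 1, 2, 3} (by simp) (by simp)).ne_top hlt.le)
  -- the section `s_u`, the Cartier datum `J₀ = (u)·𝒪` and the closed set `Z = closure {η}`
  let su : Γ(X₁, ⊤) := (Scheme.ΓSpecIso (.of R)).inv (mk (X 0))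
  let J₀ : X₁.IdealSheafData := Scheme.IdealSheafData.ofIdealTop (Ideal.span {su})
  let Z : Set X₁ := closure {η}
  have hZ : IsClosed Z := isClosed_closure
  have hsuppJ₀ : ∀ x : X₁, x ∈ (J₀.support : Set X₁) ↔ mk (X 0) ∈ x.asIdeal := fun x =>
    mem_support_ofIdealTop_iff k F (mk (X 0)) x
  have hZmem : ∀ x : X₁, x ∈ Z ↔ η ⤳ x := fun x => specializes_iff_mem_closure.symm
  have hZsub : Z ⊆ (J₀.support : Set X₁) := fun x hx =>
    (hsuppJ₀ x).mpr ((hspec η x).mp ((hZmem x).mp hx) (hXmem _ 0 (by simp)))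
  -- `J₀` is an effective Cartier divisor: `u` is a regular generator on the affine `X₁`
  have hcart : IsEffectiveCartier J₀ := by
    intro x
    refine ⟨⟨⊤, isAffineOpen_top X₁⟩, trivial, su, ?_, ?_⟩
    · haveI : IsDomain Γ(X₁, ⊤) := MulEquiv.isDomain R (Scheme.ΓSpecIso (.of R)).commRingCatIsoToRingEquiv.toMulEquiv
      refine mem_nonZeroDivisors_of_ne_zero fun h0 => WildPinchCylinder.mk_X_ne_zero k F hF 0 ?_
      have hinj : Function.Injective (Scheme.ΓSpecIso (.of R)).inv :=
        (Scheme.ΓSpecIso (.of R)).commRingCatIsoToRingEquiv.symm.injective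
      exact hinj (h0.trans (map_zero _).symm)
    · rw [Scheme.IdealSheafData.ofIdealTop_ideal]
      have h1 : (homOfLE (le_top : ((⊤ : X₁.Opens)) ≤ ⊤)) = 𝟙 _ := Subsingleton.elim _ _
      change (Ideal.span {su}).map (X₁.presheaf.map (homOfLE (le_top : ((⊤ : X₁.Opens)) ≤ ⊤)).op).hom = Ideal.span {su}
      rw [h1, op_id, X₁.presheaf.map_id, CommRingCat.hom_id, Ideal.map_id]
  -- every blow-up along `J₀` is an isomorphism, so `J₀` is good wherever `X₁` is FULL: over `V(u) ∖ V(u,t,y)` (regular points)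
  have hgood : FCUnguardedAprime.GoodOver 2 X₁ J₀ ((J₀.support : Set X₁) \ Z) := by
    intro X₂ π hπ
    haveI : IsIso π := hπ.isIso hcart
    have hfull : ∀ x : X₂, π.base x ∈ (J₀.support : Set X₁) \ Z → FullCl 2 (X₂.presheaf.stalk x) := by
      intro x hx
      have hu : mk (X 0) ∈ (π.base x).asIdeal := (hsuppJ₀ _).mp hx.1
      have ht : mk (X 1) ∉ (π.base x).asIdeal := by
        intro ht
        apply hx.2
        rw [hZmem, hspec]
        change (Ideal.span (MvPolynomial.X '' ({0, 1, 2} : Set (Fin 5)) : Set (MvPolynomial (Fin 5) k))).map mk ≤ _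
        rw [Ideal.map_span, Ideal.span_le]
        rintro _ ⟨_, ⟨i, hi, rfl⟩, rfl⟩
        simp only [Set.mem_insert_iff, Set.mem_singleton_iff] at hi
        rcases hi with rfl | rfl | rfl
        · exact hu
        · exact ht
        · exact mk_X2_mem_of_mk_X0_mem k F hF _ hu
      have h1 : FullCl 2 (Localization.AtPrime (π.base x).asIdeal) :=
        WildPinchCylinder.fullCl_localization_of_X1_not_mem k F hF (π.base x).asIdeal ht
      have h2 : FullCl 2 (X₁.presheaf.stalk (π.base x)) := WFixAtNonClosedDimTwo.fullCl_of_ringEquiv 2 (estalk _).symm h1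
      exact WFixAtNonClosedDimTwo.fullCl_of_ringEquiv 2 (asIso (π.stalkMap x)).commRingCatIsoToRingEquiv h2
    exact ⟨fun x hx _ => hfull x hx, fun x hx _ => RelClosedSubsetFixFinite.cmCl_of_fullCl (hfull x hx)⟩
  -- apply the residual
  obtain ⟨J, n, hn, hJeq, hJgood⟩ := h 2 Nat.prime_two k X₁ f₁ hsep hft hqc hint h4 hCM J₀ Z hZ hZsub hgood
  -- `η ∈ supp J`, tested at the generization `ξ₀ ∉ Z`
  have hnotZ : ∀ y : X₁, y ⤳ η → y ≠ η → y ∉ Z := fun y hy hne hyZ => hne (hy.antisymm ((hZmem y).mp hyZ)).eq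
  have hξsupp : ξ₀ ∈ (J.support : Set X₁) := by
    have h0 : ξ₀ ∈ (J₀.support : Set X₁) := (hsuppJ₀ _).mpr (hXmem _ 0 (by simp))
    change ξ₀ ∈ J.support
    rw [mem_support_iff_stalkIdeal_le, hJeq ξ₀ (hnotZ ξ₀ hξη hξne)]
    obtain ⟨m', rfl⟩ := Nat.exists_eq_succ_of_ne_zero hn.ne'
    exact (Ideal.IsPrime.pow_le_iff m'.succ_ne_zero).mpr ((mem_support_iff_stalkIdeal_le J₀ ξ₀).mp h0)
  have hηsupp : η ∈ (J.support : Set X₁) := hξη.mem_closed J.support.isClosed hξsupp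
  -- generators of `J_η` and the agreement at the proper generizations of `η`
  obtain ⟨m, c, hc⟩ := Submodule.fg_iff_exists_fin_generating_family.mp (IsNoetherian.noetherian (stalkIdeal J η))
  have hagree : ∀ y : X₁, y ⤳ η → y ≠ η → stalkIdeal J y = stalkIdeal J₀ y ^ n := fun y hy hne => hJeq y (hnotZ y hy hne)
  -- the hypothesis denies FULL charts of `J_η` over `𝔪_η` …
  have hnot := hW k F hF η rfl J n m c hn hc hagree
  apply hnot
  -- … but the residual forces them: points of a blow-up over the non-closed `η` are non-closed, hence FULL
  intro j 𝔔 h𝔔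
  obtain ⟨X₂, π, hπ⟩ := exists_isBlowup X₁ J
  obtain ⟨x', hx', ⟨e⟩⟩ := hπ.exists_point_of_blowupAlgebra_prime η c hc j 𝔔 h𝔔
  have hx'ncl : ¬ IsClosed ({x'} : Set X₂) := by
    intro hcl
    haveI : IsProper π := hπ.isProper
    have himg : IsClosed (π.base '' {x'}) := π.isClosedMap _ hcl
    rw [Set.image_singleton] at himg
    exact hηncl (hx' ▸ himg)
  have hfx : FullCl 2 (X₂.presheaf.stalk x') := (hJgood X₂ π hπ).1 x' (hx' ▸ hηsupp) hx'ncl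
  exact WFixAtNonClosedDimTwo.fullCl_of_ringEquiv 2 e hfx

/-- **The exact residual (T3′) `RelClosedSubsetFix` is false too** (it implies the power form with `n = 1`,
`FCUnguardedAprime.relClosedSubsetFixPow_of_fix`). [plumbing] -/
theorem relClosedSubsetFix_false_of_W (hW : WildPinchCylinderNoRelativeBlowupCure) : ¬ FCUnguardedAprime.RelClosedSubsetFix :=
  fun h => relClosedSubsetFixPow_false_of_W hW (FCUnguardedAprime.relClosedSubsetFixPow_of_fix h)

end Summit.ResolutionOfSingularities.ResolutionOfSingularities.Theorems.FInjectiveMacaulayfication.RelClosedSubsetFixPowFalseOfW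

end
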